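import Literature.MathematicalPhysics.QuantumFieldTheory.Balaban1983to89.B9Eq3126H1kPiSupRowClosed

/-!
# `Balaban1983to89.B9Eq3147MiddleWordPiSupRowClosed` — T. Bałaban, *Propagators for lattice gauge theories in a background field*, Commun. Math. Phys. **99** (1985)
# 389–434 [Balaban1985BackgroundPropagators] (3.147) p. 425, (3.153) p. 426, (3.126) p. 420, Thm 3.13 p. 426; [Balaban1985Variational] (110)–(111) p. 294
# (*«𝔊 = G − GQ*(QGQ*)⁻¹QG − GDRD*G»*): **THE LOCAL SUP LETTER OF THE MIDDLE WORD `H̃_kQ_kG̃_k` OF `𝔊̃_k` ON THE CELL's MODEL, ∃-FIRST, HEIGHT-FREE** — (K66)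
# `B9Eq3147MiddleWordSupRowClosed` RE-RUN AT PRINT's `G̃_k` (the NE9 owner's RULING R-ne9p1-g97-4 (2)(b), journal `HOME/CLAIMS.log` l.66556): two `letter_comp` of
# (L)(G̃_k) = (K77), (L)(Q_k) = (K66)'s station, (L)(H̃_k) = (K81)

statement-level skeleton of published theorems with citation tags; proofs where landed; nothing here is a claim about the Yang–Mills mass gap

CITATION HEADER (lean-in-tree rule).  Audit cell `pub-balaban`, sub-cell `t4`, BINDER row NE9; NE9 crux-team LEAF PROVER 05 (`b2b-balaban-t4-ne9-formalise-leaf-05`, gen 88;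
(K82)).  Composed BY NAME: (K77) `exists_local_letters_G1LatticeKPi`, (K81) `exists_local_letter_H1LatticeKPi`, `B9Eq316PenaltyStencilLetterTower.norm_equiv_QkW_apply_le_blocks`,
`B9Eq315QkLocalLetter.QkOfU_apply_eq_zero_of_support`, (K63) `letter_of_range`, (K61) `letter_comp` ×2.  Source READ first-hand (`paper:balaban1985-cmp99-background-propagators`,
PDF + 388): pp. 420, 425–426.  [folklore] letter algebra; NOTHING of print's (3.147) ∕ (3.153) ∕ Thm 3.13 is asserted, valued or discharged.
WHAT IS PROVED (sorry-free; no `def`).  **`exists_local_letter_H1kPiQkG1kPi`**: `∃ (α₁, j₁, B, δ)` BEFORE (K80)'s binder block such that for every fine-bond field `f`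
supported over `Π⁻¹(v)` with `‖f‖_∞ ≤ F` and every fine bond `b`: `‖(H̃_k(Q_k(G̃_kf)))(b)‖ ≤ B·e^{−δ·d_m(Π(b₋), v)}·F` — `B = B_T·(C_Q·2√d·e^κ)·K·B_H·K`, `δ = κ∕2`,
`κ = min(δ_K77, δ_K81)`, `j₁ = min`, `α₁ = min` (the `Q_k` size is read through the window `α₁`, as in (K66)).
HONEST SCOPE.  `hpos′`, `hpos`, `hposπ`, `hQ`, the windows, E162's data, `c₀ = η^d`, `‖J‖ ≤ j₀` stay HYPOTHESES; constants crude; «NE9 ⇐ the named binders»; NE9 NOT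
PRINTED ∕ NOT PROVED; row WALLED ON A MODEL (O-NE9-1; #5 UNRULED); spine PROVED 0∕9; rung (B)+1 on a finite T⁴ — NOT infinite volume, NOT mass gap, NOT BetaPertH, NOT
Clay.  HONEST DEPENDENCY: continuum YM on T⁴ ⇐ BetaPertH ∧ nine spine estimates (0/9 proved); BetaPertH ⇐ (D1) ∧ (D4) ∧ CAP+tail; G-an2-4 gates asym, D1 and NE2/3/4.
NEW file importing (K81) only; nothing modified.  Net new unproved facts: 0.
-/

noncomputable section

set_option autoImplicit false

open scoped InnerProductSpace ComplexConjugate BigOperators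

namespace Literature.MathematicalPhysics.QuantumFieldTheory.Balaban1983to89.B9Eq3147MiddleWordPiSupRowClosed



open B4Sect5Torus (TSite tdist tdist_nonneg tdist_symm tdist_self tdist_triangle torusSum_le)
open B4Sect5Proof (latticeConst latticeConst_nonneg)
open B9SectCLatticeCarrier (Bond DirPair bpos btgt shift unshift)
open B9Eq311L2Pairing (WL2)
open B9Eq319QprimeTorus (fineP blockCoord)
open B7Prop1Explicit (U1 Wcx boxVec)
open B11Eq103H1Complex (SiteL2K BondL2K greenK covDerivL2K covDivL2K G1LatticeK KinvLatticeK H1LatticeK)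
open B9Eq310DeltaPrime (plaqHolU)
open B9Eq310HessianOperator (adTransportW hessOp)
open B9Eq310HessianHermitian (adTransportW_adjoint)
open B9Eq315QTorus (perCfg cornerSite)
open B9Eq315QTower (towerP UlevOf)
open B9Eq316TowerFlatIsOneStep (towerP_eq_fineP_pow siteCast)
open B9Eq326OperatorTower (QprimeTowerW QkW RofUk laplaceAk G1k)
open B9Eq324DeltaPrimeATower (laplacePrimeAk GpOfUk)
open B9Eq33CovDerivLocalLetterTower (tdist_bigBlock_bpos_btgt_le_one)
open B9Eq3117GaugeModeStencilLettersTower (local_hessOp_covDerivL2K_tower local_covDivL2K_hessOp_tower)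
open B9Eq3130GtildePairRowsClosedTower (exists_local_letters_G1LatticeKPi)
open B9Eq3126H1kPiSupRowClosed (exists_local_letter_H1LatticeKPi)
open B9Eq3119DeltaPiTower (piOfUk laplaceAkPi)

variable {d : ℕ} (hd : 1 ≤ d) (L : ℕ) [NeZero L] (hL : 1 ≤ L) (hL3 : 3 ≤ L)
  {𝔸 : Type*} [NormedRing 𝔸] [NormedAlgebra ℂ 𝔸] [CompleteSpace 𝔸] [NormOneClass 𝔸] [StarRing 𝔸] [NormedStarGroup 𝔸] [StarModule ℂ 𝔸]
  {W : Type*} [NormedAddCommGroup W] [InnerProductSpace ℂ W] [FiniteDimensional ℂ W] (φ : W ≃ₗ[ℂ] 𝔸)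
  {Mφ Mφ' : ℝ} (hMφ : 0 ≤ Mφ) (hMφ' : 0 ≤ Mφ') (hφ : ∀ w, ‖φ w‖ ≤ Mφ * ‖w‖) (hφ' : ∀ X, ‖φ.symm X‖ ≤ Mφ' * ‖X‖) (hstar : ∀ X : 𝔸, ‖star X‖ ≤ ‖X‖)
  {a : ℝ} (ha : 0 < a) {a' : ℝ} (ha' : 0 < a') {ϱ : ℝ} (hϱ0 : 0 ≤ ϱ) (hϱ1 : ϱ < 1)
  (τ : 𝔸 →ₗ[ℂ] ℂ) {Cτ : ℝ} (hτ : ∀ X, ‖τ X‖ ≤ Cτ * ‖X‖) (hCτ : 0 ≤ Cτ) {Mτ : ℝ} (hτm : ∀ X Y : 𝔸, ‖τ (X * Y)‖ ≤ Mτ * ‖X‖ * ‖Y‖) (hMτ : 0 ≤ Mτ)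
  {ρw : ℝ} (hρw : 0 ≤ ρw)
  (hτ₁ : ∀ X : 𝔸, τ (star X) = conj (τ X)) (hτ₂ : ∀ X Y : 𝔸, τ (X * Y) = τ (Y * X)) (hφτ : ∀ X Y : 𝔸, ⟪φ.symm X, φ.symm Y⟫_ℂ = τ (star X * Y))
  (AQ : ℝ)

open B9Eq326G1SupRowOfLetters (letter_comp letter_mono)
open B9Eq3126H1SupRowOfLetters (letter_of_range)
open B9Eq349BlockMultipliers (exists_block_clm_family)
open B9Eq349BlockDistanceWeight (tdist_shift_le_one)
open B9Eq315QkLocalLetter (QkOfU_apply_eq_zero_of_support)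
open B9Eq315QkSingleBondLetter (equiv_QkW_apply)
open B9Eq316PenaltyStencilLetterTower (norm_equiv_QkW_apply_le_blocks)
open B9Eq347LocalFromBlockDecay (norm_le_sqrt_mass_mul)
open B9Eq326LocalPartTowerSupDecayDiagonalClosed (sum_bondMass_bigBlock_le)

omit [NeZero L] in
/-- `e^{−r t} ≤ e^{−κ t}` for `κ ≤ r`, `0 ≤ t`. [folklore] -/
private theorem exp_weaken' {r κ t : ℝ} (hκ : κ ≤ r) (ht : 0 ≤ t) : Real.exp (-(r * t)) ≤ Real.exp (-(κ * t)) :=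
  Real.exp_le_exp.2 (by nlinarith)

set_option maxHeartbeats 400000 in -- margin only: passes at the default 200 000 (cert), but the sibling (K76) sat on the farm's heartbeat cliff (ops-buildfix-2 g21, HOME/INBOX 19:03Z) — same binder block, same shape
include hd hL hL3 hMφ hMφ' hφ hφ' hstar ha ha' hϱ0 hϱ1 hτ hCτ hτm hMτ hρw hτ₁ hτ₂ hφτ in
/-- **THE LOCAL SUP LETTER OF THE MIDDLE WORD `H̃_kQ_kG̃_k`** — two (K61) `letter_comp` of (L)(G̃_k; B_T, κ) ((K77) `.1`), (L)(Q_k; C_Q·2√d·e^κ, κ) ((K66)'s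
station: `norm_equiv_QkW_apply_le_blocks` through the window, range `1`, `letter_of_range`), (L)(H̃_k; B_H, κ) ((K81)); `κ = min` of the two rates, one rate loss.
[cite: Balaban1985BackgroundPropagators, (3.147) p.425, (3.153) p.426, (3.126) p.420, Thm 3.13 p.426] [cite: Balaban1985Variational, (110)–(111) p.294] -/
theorem exists_local_letter_H1kPiQkG1kPi :
    ∃ α₁ j₁ B δ : ℝ, 0 < α₁ ∧ 0 < j₁ ∧ 0 ≤ B ∧ 0 < δ ∧
      ∀ (n : ℕ) (η : ℝ) (_hηL : η * (L : ℝ) ^ (n + 1) = 1) (c₀ c₁ : ℝ) [Fact (0 < c₀)] [Fact (0 < c₁)]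
        (_hw : c₀ * ((L : ℝ) ^ (n + 1)) ^ d = c₁) (_hρ : |η| ^ d / c₀ ≤ ρw) (m : Fin d → ℕ) [∀ i, NeZero (m i)] (_hm : ∀ i, 1 ≤ m i)
        (U : Bond d (towerP L m (n + 1)) → 𝔸ˣ) (αU : ℕ → ℝ) (_hα0 : ∀ j, 0 ≤ αU j) (hα1 : ∀ j, αU j ≤ 1 / 64)
        (hαL : ∀ j, 50 * (d + 1) * αU j * (L : ℝ) ^ d ≤ 1 / 2)
        (hU1 : ∀ (j : ℕ) (x : B7Prop1Explicit.Site d) (k : Fin d), perCfg (towerP L m (j + 1)) (UlevOf L m (n + 1) U j) x k ∈ U1 𝔸)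
        (hreg : ∀ (j : ℕ) (y : TSite d (towerP L m j)) (k : Fin d) (ρ' : Fin d → Fin L),
          ‖((Wcx L (perCfg (towerP L m (j + 1)) (UlevOf L m (n + 1) U j)) (cornerSite L y) k (boxVec L ρ') : 𝔸ˣ) : 𝔸) - 1‖ ≤ αU j)
        (εU : ℕ → ℝ) (_hεU : ∀ j, 0 ≤ εU j) (_hUε : ∀ (j : ℕ) (b : Bond d (towerP L m (j + 1))), ‖(UlevOf L m (n + 1) U j b : 𝔸) - 1‖ ≤ εU j)
        (_hLb : ∀ (j : ℕ) (b : Bond d (towerP L m (j + 1))), UlevOf L m (n + 1) U j b ∈ U1 𝔸)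
        (α : ℝ) (_hα : 0 ≤ α) (_hαle : α ≤ α₁)
        (hUst : ∀ b, star (U b : 𝔸) = (((U b)⁻¹ : 𝔸ˣ) : 𝔸)) (_hUb : ∀ b, U b ∈ U1 𝔸) (_hUη : ∀ b, ‖(U b : 𝔸) - 1‖ ≤ α * η)
        (_hpl : ∀ p : B9SectCLatticeCarrier.Plaq d (towerP L m (n + 1)), ‖(plaqHolU U p : 𝔸) - 1‖ ≤ α * η ^ 2)
        (_hUgrad : ∀ (x : TSite d (towerP L m (n + 1))) (μ : Fin d), ‖(U (x, μ) : 𝔸) - U (unshift μ x, μ)‖ ≤ α * η ^ 2)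
        (_hRlev : ∀ (j : ℕ) (b : Bond d (towerP L m (j + 1))) (w : W), ‖adTransportW φ (UlevOf L m (n + 1) U j) b w‖ ≤ ‖w‖)
        (_hεg : ∀ j < n + 1, εU j ≤ α * ϱ ^ j) (_hAQ : ∑ j ∈ Finset.range (n + 1), αU j ≤ AQ)
        (hpos' : ∀ x : SiteL2K ℂ d (towerP L m (n + 1)) c₀ W, x ≠ 0 → 0 < RCLike.re ⟪x, laplacePrimeAk L m n φ η U a' (c₁ := c₁) x⟫_ℂ)
        (hpos : ∀ x : BondL2K ℂ d (towerP L m (n + 1)) c₀ W, x ≠ 0 →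
          0 < RCLike.re ⟪x, laplaceAk L m n φ η U hL αU hα1 hU1 hreg τ (c₀ := c₀) (c₁ := c₁) a x⟫_ℂ)
        (_hc₀η : c₀ = η ^ d) (j₀ : ℝ) (_hJ : ∀ μ y, ‖B9Eq39Adjoint.J (fun μ => B9Eq33CovDerivVector.shiftEquiv μ) (fun μ y => U (y, μ)) η μ y‖ ≤ j₀) (_hj : j₀ ≤ j₁)
        (hposπ : ∀ x : BondL2K ℂ d (towerP L m (n + 1)) c₀ W, x ≠ 0 →
          0 < RCLike.re ⟪x, laplaceAkPi L m n φ τ η U a' hpos' hL αU hα1 hU1 hreg (c₁ := c₁) a x⟫_ℂ)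
        (hQ : Function.Surjective (QkW L m n φ U hL αU hα1 hU1 hreg (c₀ := c₀) (c₁ := c₁)))
        (v : TSite d m) (f : BondL2K ℂ d (towerP L m (n + 1)) c₀ W) (F : ℝ)
        (_hfv : ∀ x, blockCoord (L ^ (n + 1)) m (siteCast (towerP_eq_fineP_pow L m (n + 1)) (bpos x)) ≠ v →
          WL2.equiv ℂ (fun _ : Bond d (towerP L m (n + 1)) => c₀) W f x = 0)
        (_hfF : ∀ x, ‖WL2.equiv ℂ (fun _ : Bond d (towerP L m (n + 1)) => c₀) W f x‖ ≤ F) (b : Bond d (towerP L m (n + 1))),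
        ‖WL2.equiv ℂ (fun _ : Bond d (towerP L m (n + 1)) => c₀) W (H1LatticeK hposπ hQ (QkW L m n φ U hL αU hα1 hU1 hreg (c₀ := c₀) (c₁ := c₁) (G1LatticeK hposπ f))) b‖ ≤
          B * Real.exp (-(δ * tdist m (blockCoord (L ^ (n + 1)) m (siteCast (towerP_eq_fineP_pow L m (n + 1)) (bpos b))) v)) * F := by
  classical
  obtain ⟨αT, jT, BT, δT, hαT, hjT, hBT, hδT, HT⟩ :=
    exists_local_letters_G1LatticeKPi hd L hL hL3 φ hMφ hMφ' hφ hφ' hstar ha ha' hϱ0 hϱ1 τ hτ hCτ hτm hMτ hρw hτ₁ hτ₂ hφτ AQ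
  obtain ⟨αH, jH, BH, δH, hαH, hjH, hBH, hδH, HH⟩ :=
    exists_local_letter_H1LatticeKPi hd L hL hL3 φ hMφ hMφ' hφ hφ' hstar ha ha' hϱ0 hϱ1 τ hτ hCτ hτm hMτ hρw hτ₁ hτ₂ hφτ AQ
  obtain ⟨αs, hαs⟩ : ∃ αs : ℝ, αs = min αT αH := ⟨_, rfl⟩
  have hαs0 : 0 < αs := by rw [hαs]; exact lt_min hαT hαH
  obtain ⟨κ, hκdef⟩ : ∃ κ : ℝ, κ = min δT δH := ⟨_, rfl⟩
  have hκ0 : 0 < κ := by rw [hκdef]; exact lt_min hδT hδH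
  have hκT : κ ≤ δT := by rw [hκdef]; exact min_le_left _ _
  have hκH : κ ≤ δH := by rw [hκdef]; exact min_le_right _ _
  obtain ⟨K, hKdef⟩ : ∃ K : ℝ, K = latticeConst d (κ - κ / 2) := ⟨_, rfl⟩
  have hK0 : 0 ≤ K := by rw [hKdef]; exact latticeConst_nonneg d (sub_pos.2 (half_lt_self hκ0)).le
  have h1ϱ : 0 < 1 - ϱ := by linarith only [hϱ1]
  obtain ⟨CQ, hCQ⟩ : ∃ C : ℝ, C = Mφ' * Mφ * Real.exp (Real.sqrt ((L : ℝ) ^ d) * (Real.sqrt (2 * d) * (102 * (d + 1) ^ 2 * L)) * (αs / (1 - ϱ))) := ⟨_, rfl⟩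
  have hCQ0 : 0 ≤ CQ := by rw [hCQ]; positivity
  obtain ⟨Bs, hBs⟩ : ∃ B : ℝ, B = BT * (CQ * (2 * Real.sqrt d) * Real.exp (κ * 1)) * K * BH * K := ⟨_, rfl⟩
  have hBs0 : 0 ≤ Bs := by rw [hBs]; positivity
  have hW0 : 0 ≤ Real.sqrt ((L : ℝ) ^ d) * (Real.sqrt (2 * d) * (102 * (d + 1) ^ 2 * L)) := by positivity
  refine ⟨αs, min jT jH, Bs, κ / 2, hαs0, lt_min hjT hjH, hBs0, half_pos hκ0, ?_⟩
  intro n η hηL c₀ c₁ _ _ hw hρ m _ hm U αU hα0 hα1 hαL hU1 hreg εU hεU hUε hLb α hα hαle hUst hUb hUη hpl hUgrad hRlev hεg hAQ hpos' hpos hc₀η j₀ hJ hj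
    hposπ hQ v f F hfv hfF b
  have hc₀ : (0 : ℝ) < c₀ := Fact.out
  have hc₁ : (0 : ℝ) < c₁ := Fact.out
  haveI : Nonempty (Bond d (towerP L m (n + 1))) := ⟨b⟩
  haveI : Nonempty (Bond d m) := ⟨(v, ⟨0, hd⟩)⟩
  have y₀ : TSite d (towerP L m (n + 1)) := b.1
  have b' : Bond d m := (v, ⟨0, hd⟩)
  have hF0 : 0 ≤ F := (norm_nonneg _).trans (hfF b)
  have hαT_ : α ≤ αT := hαle.trans (by rw [hαs]; exact min_le_left _ _)
  have hαH_ : α ≤ αH := hαle.trans (by rw [hαs]; exact min_le_right _ _)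
  have hjT_ : j₀ ≤ jT := hj.trans (min_le_left _ _)
  have hjH_ : j₀ ≤ jH := hj.trans (min_le_right _ _)
  -- the family and the three CLMs
  obtain ⟨PB, hPB⟩ := exists_block_clm_family (𝕜 := ℂ) (w := fun _ : Bond d (towerP L m (n + 1)) => c₀) (V := W)
    (fun x : Bond d (towerP L m (n + 1)) => blockCoord (L ^ (n + 1)) m (siteCast (towerP_eq_fineP_pow L m (n + 1)) (bpos x)))
  obtain ⟨Gtcl, hGtcl⟩ : ∃ T : BondL2K ℂ d (towerP L m (n + 1)) c₀ W →L[ℂ] BondL2K ℂ d (towerP L m (n + 1)) c₀ W,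
      T = LinearMap.toContinuousLinearMap (G1LatticeK hposπ) := ⟨_, rfl⟩
  obtain ⟨Qcl, hQcl⟩ : ∃ T : BondL2K ℂ d (towerP L m (n + 1)) c₀ W →L[ℂ] BondL2K ℂ d m c₁ W, T = LinearMap.toContinuousLinearMap (QkW L m n φ U hL αU hα1 hU1 hreg (c₀ := c₀) (c₁ := c₁)) := ⟨_, rfl⟩
  obtain ⟨Hcl, hHcl⟩ : ∃ T : BondL2K ℂ d m c₁ W →L[ℂ] BondL2K ℂ d (towerP L m (n + 1)) c₀ W, T = LinearMap.toContinuousLinearMap (H1LatticeK hposπ hQ) := ⟨_, rfl⟩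
  -- (L)(G̃_k; B_T, κ)
  have hG : ∀ (v : TSite d m) (f : BondL2K ℂ d (towerP L m (n + 1)) c₀ W) (F : ℝ),
      (∀ x, blockCoord (L ^ (n + 1)) m (siteCast (towerP_eq_fineP_pow L m (n + 1)) (bpos x)) ≠ v → WL2.equiv ℂ (fun _ : Bond d (towerP L m (n + 1)) => c₀) W f x = 0) →
      (∀ x, ‖WL2.equiv ℂ (fun _ : Bond d (towerP L m (n + 1)) => c₀) W f x‖ ≤ F) →
      ∀ x, ‖WL2.equiv ℂ (fun _ : Bond d (towerP L m (n + 1)) => c₀) W (Gtcl f) x‖ ≤ BT * Real.exp (-(κ * tdist m (blockCoord (L ^ (n + 1)) m (siteCast (towerP_eq_fineP_pow L m (n + 1)) (bpos x))) v)) * F := by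
    intro v f F hfv hfF x
    have hF : 0 ≤ F := (norm_nonneg _).trans (hfF x)
    rw [hGtcl, LinearMap.coe_toContinuousLinearMap']
    exact (HT n η hηL c₀ c₁ hw hρ m hm U αU hα0 hα1 hU1 hreg εU hεU hUε hLb α hα hαT_ hUst hUb hUη hpl hUgrad hRlev hεg hAQ hpos' hpos hc₀η j₀ hJ hjT_
      hposπ v f F hfv hfF x x.1).1.trans
      (mul_le_mul_of_nonneg_right (mul_le_mul_of_nonneg_left (exp_weaken' hκT (tdist_nonneg m _ _)) hBT) hF)
  -- (L)(H̃_k; B_H, κ)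
  have hH : ∀ (v : TSite d m) (z : BondL2K ℂ d m c₁ W) (F : ℝ), (∀ x, bpos x ≠ v → WL2.equiv ℂ (fun _ : Bond d m => c₁) W z x = 0) →
      (∀ x, ‖WL2.equiv ℂ (fun _ : Bond d m => c₁) W z x‖ ≤ F) →
      ∀ x, ‖WL2.equiv ℂ (fun _ : Bond d (towerP L m (n + 1)) => c₀) W (Hcl z) x‖ ≤ BH * Real.exp (-(κ * tdist m (blockCoord (L ^ (n + 1)) m (siteCast (towerP_eq_fineP_pow L m (n + 1)) (bpos x))) v)) * F := by
    intro v z F hzv hzF x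
    have hF : 0 ≤ F := (norm_nonneg _).trans (hzF b')
    rw [hHcl, LinearMap.coe_toContinuousLinearMap']
    exact (HH n η hηL c₀ c₁ hw hρ m hm U αU hα0 hα1 hαL hU1 hreg εU hεU hUε hLb α hα hαH_ hUst hUb hUη hpl hUgrad hRlev hεg hAQ hpos' hpos hc₀η j₀ hJ hjH_
      hposπ hQ v z F hzv hzF x).trans
      (mul_le_mul_of_nonneg_right (mul_le_mul_of_nonneg_left (exp_weaken' hκH (tdist_nonneg m _ _)) hBH) hF)
  -- (L)(Q_k; C_Q·2√d·e^κ, κ): size from the block letter (height-free through the window), range `1`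
  have hμB : ∀ u : TSite d m, ∑ x : Bond d (towerP L m (n + 1)), (if blockCoord (L ^ (n + 1)) m (siteCast (towerP_eq_fineP_pow L m (n + 1)) (bpos x)) = u then c₀ else 0) ≤ (d : ℝ) * c₁ := by
    intro u
    have h := sum_bondMass_bigBlock_le L m n hc₀.le u
    calc _ ≤ c₀ * (d * ((L : ℝ) ^ (n + 1)) ^ d) := h
      _ = (d : ℝ) * c₁ := by rw [← hw]; ring
  have hblk : ∀ (u : BondL2K ℂ d (towerP L m (n + 1)) c₀ W) (F : ℝ), 0 ≤ F →
      (∀ x, ‖WL2.equiv ℂ (fun _ : Bond d (towerP L m (n + 1)) => c₀) W u x‖ ≤ F) → ∀ y : TSite d m, ‖PB y u‖ ≤ Real.sqrt ((d : ℝ) * c₁) * F := by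
    intro u F hF huF y
    refine norm_le_sqrt_mass_mul (w := fun _ : Bond d (towerP L m (n + 1)) => c₀) (π := fun x : Bond d (towerP L m (n + 1)) => blockCoord (L ^ (n + 1)) m (siteCast (towerP_eq_fineP_pow L m (n + 1)) (bpos x)))
      y (hμB y) (PB y u) hF (fun x hx => ?_) (fun x => ?_)
    · rw [hPB, if_neg hx]
    · rw [hPB]
      by_cases hx : blockCoord (L ^ (n + 1)) m (siteCast (towerP_eq_fineP_pow L m (n + 1)) (bpos x)) = y
      · rw [if_pos hx]; exact huF x
      · rw [if_neg hx, norm_zero]; exact hF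
  have hsd2 : Real.sqrt ((d : ℝ) * c₁) = Real.sqrt d * Real.sqrt c₁ := Real.sqrt_mul (Nat.cast_nonneg d) c₁
  have hsc : 0 < Real.sqrt c₁ := Real.sqrt_pos.2 hc₁
  have hexpα : Real.exp (Real.sqrt ((L : ℝ) ^ d) * (Real.sqrt (2 * d) * (102 * (d + 1) ^ 2 * L)) * (α / (1 - ϱ))) ≤
      Real.exp (Real.sqrt ((L : ℝ) ^ d) * (Real.sqrt (2 * d) * (102 * (d + 1) ^ 2 * L)) * (αs / (1 - ϱ))) :=
    Real.exp_le_exp.2 (mul_le_mul_of_nonneg_left (div_le_div_of_nonneg_right hαle h1ϱ.le) hW0)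
  have hQM : ∀ (u : BondL2K ℂ d (towerP L m (n + 1)) c₀ W) (F : ℝ), (∀ x, ‖WL2.equiv ℂ (fun _ : Bond d (towerP L m (n + 1)) => c₀) W u x‖ ≤ F) →
      ∀ c, ‖WL2.equiv ℂ (fun _ : Bond d m => c₁) W (Qcl u) c‖ ≤ CQ * (2 * Real.sqrt d) * F := by
    intro u F huF c
    have hF : 0 ≤ F := (norm_nonneg _).trans (huF (y₀, b'.2))
    have h := norm_equiv_QkW_apply_le_blocks L m n φ U hL αU hα1 hU1 hreg hMφ hφ hMφ' hφ' εU hεU hUε hϱ0 hϱ1 hα hεg hPB hw.symm u c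
    have h1 := hblk u F hF huF c.1
    have h2 := hblk u F hF huF (shift c.2 c.1)
    rw [hQcl, LinearMap.coe_toContinuousLinearMap']
    refine h.trans ?_
    calc Mφ' * Mφ * Real.exp (Real.sqrt ((L : ℝ) ^ d) * (Real.sqrt (2 * d) * (102 * (d + 1) ^ 2 * L)) * (α / (1 - ϱ))) / Real.sqrt c₁ *
          (‖PB c.1 u‖ + ‖PB (shift c.2 c.1) u‖)
        ≤ Mφ' * Mφ * Real.exp (Real.sqrt ((L : ℝ) ^ d) * (Real.sqrt (2 * d) * (102 * (d + 1) ^ 2 * L)) * (αs / (1 - ϱ))) / Real.sqrt c₁ *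
          (Real.sqrt ((d : ℝ) * c₁) * F + Real.sqrt ((d : ℝ) * c₁) * F) := by
          refine mul_le_mul ?_ (add_le_add h1 h2) (add_nonneg (norm_nonneg _) (norm_nonneg _)) (div_nonneg (hCQ ▸ hCQ0) hsc.le)
          exact div_le_div_of_nonneg_right (mul_le_mul_of_nonneg_left hexpα (mul_nonneg hMφ' hMφ)) hsc.le
      _ = CQ * (2 * Real.sqrt d) * F := by
          rw [hCQ, hsd2]
          field_simp
          ring
  have hQρ : ∀ (v : TSite d m) (u : BondL2K ℂ d (towerP L m (n + 1)) c₀ W),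
      (∀ x, blockCoord (L ^ (n + 1)) m (siteCast (towerP_eq_fineP_pow L m (n + 1)) (bpos x)) ≠ v → WL2.equiv ℂ (fun _ : Bond d (towerP L m (n + 1)) => c₀) W u x = 0) →
      ∀ c : Bond d m, (1 : ℝ) < tdist m (bpos c) v → WL2.equiv ℂ (fun _ : Bond d m => c₁) W (Qcl u) c = 0 := by
    intro v u huv c hc
    have h1 : c.1 ≠ v := by
      intro h1
      have : tdist m (bpos c) v = 0 := by rw [show bpos c = c.1 from rfl, h1, tdist_self]
      linarith only [this, hc]
    have h2 : shift c.2 c.1 ≠ v := by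
      intro h2
      have : tdist m (bpos c) v ≤ 1 := by rw [show bpos c = c.1 from rfl, ← h2]; exact tdist_shift_le_one hm c.1 c.2
      linarith only [this, hc]
    rw [hQcl, LinearMap.coe_toContinuousLinearMap', equiv_QkW_apply,
      QkOfU_apply_eq_zero_of_support L m hL (n + 1) U αU hα1 hU1 hreg v _ (fun x hx => by rw [huv x hx, map_zero]) c h1 h2, map_zero]
  have hQf := letter_of_range (tdist m) (fun x : Bond d (towerP L m (n + 1)) => blockCoord (L ^ (n + 1)) m (siteCast (towerP_eq_fineP_pow L m (n + 1)) (bpos x))) (fun c : Bond d m => bpos c) Qcl (M := CQ * (2 * Real.sqrt d))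
    (ρ := 1) (κ := κ) hκ0.le hQM hQρ
  -- the two compositions, one rate loss
  have hS : ∀ w' : TSite d m, ∑ u : TSite d m, Real.exp (-((κ - κ / 2) * tdist m w' u)) ≤ K := fun w' => by
    rw [hKdef]; exact torusSum_le d hm (sub_pos.2 (half_lt_self hκ0)) w'
  have hMQf0 : 0 ≤ CQ * (2 * Real.sqrt d) * Real.exp (κ * 1) := mul_nonneg (mul_nonneg hCQ0 (mul_nonneg zero_le_two (Real.sqrt_nonneg _))) (Real.exp_nonneg _)
  have h₁ := letter_comp (tdist m) (fun x : Bond d (towerP L m (n + 1)) => blockCoord (L ^ (n + 1)) m (siteCast (towerP_eq_fineP_pow L m (n + 1)) (bpos x))) (fun x : Bond d (towerP L m (n + 1)) => blockCoord (L ^ (n + 1)) m (siteCast (towerP_eq_fineP_pow L m (n + 1)) (bpos x)))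
    (fun c : Bond d m => bpos c) Gtcl Qcl (tdist_nonneg m) (fun u y w' => tdist_triangle hm u y w') (B₁ := BT) (B₂ := CQ * (2 * Real.sqrt d) * Real.exp (κ * 1))
    (κ₁ := κ) (κ₂ := κ) (κ' := κ / 2) (S := K) hBT hMQf0 (half_pos hκ0).le (half_le_self hκ0.le) hG hQf hS
  have h₂ := letter_comp (tdist m) (fun x : Bond d (towerP L m (n + 1)) => blockCoord (L ^ (n + 1)) m (siteCast (towerP_eq_fineP_pow L m (n + 1)) (bpos x))) (fun c : Bond d m => bpos c)
    (fun x : Bond d (towerP L m (n + 1)) => blockCoord (L ^ (n + 1)) m (siteCast (towerP_eq_fineP_pow L m (n + 1)) (bpos x))) (Qcl ∘L Gtcl) Hcl (tdist_nonneg m) (fun u y w' => tdist_triangle hm u y w')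
    (B₁ := BT * (CQ * (2 * Real.sqrt d) * Real.exp (κ * 1)) * K) (B₂ := BH) (κ₁ := κ / 2) (κ₂ := κ) (κ' := κ / 2) (S := K)
    (mul_nonneg (mul_nonneg hBT hMQf0) hK0) hBH (half_pos hκ0).le le_rfl h₁ hH hS v f F hfv hfF b
  have e : (Hcl ∘L (Qcl ∘L Gtcl)) f = H1LatticeK hposπ hQ (QkW L m n φ U hL αU hα1 hU1 hreg (c₀ := c₀) (c₁ := c₁) (G1LatticeK hposπ f)) := by
    rw [hHcl, hQcl, hGtcl]; rfl
  rw [e] at h₂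
  refine h₂.trans (le_of_eq ?_)
  rw [hBs]

end Literature.MathematicalPhysics.QuantumFieldTheory.Balaban1983to89.B9Eq3147MiddleWordPiSupRowClosed

end
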